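import Summits.Ventures.PercRepro.RankLevelSetLevelSixT17Cell7
import Summits.Ventures.PercRepro.RankLevelSetLevelSixT17Cell8
import Summits.Ventures.PercRepro.RankLevelSetLevelSixT17Cell9
import Summits.Ventures.PercRepro.RankLevelSetLevelSixT17Cell10
import Summits.Ventures.PercRepro.RankLevelSetLevelSixT17Cell11
import Summits.Ventures.PercRepro.RankLevelSetLevelSixT17Cell12
import Summits.Ventures.PercRepro.RankLevelSetLevelSixT17Cell13
import Summits.Ventures.PercRepro.RankLevelSetLevelSixT17Cell14
import Summits.Ventures.PercRepro.RankLevelSetLevelSixT17Cell15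
import Summits.Ventures.PercRepro.RankLevelSetLevelSixT17Cell16
import Summits.Ventures.PercRepro.RankLevelSetLevelSixT17Cell17
import Summits.Ventures.PercRepro.RankLevelSetLevelSixT17Cell18
import Summits.Ventures.PercRepro.RankLevelSetLevelSixT17Cell19
import Summits.Ventures.PercRepro.RankLevelSetLevelSixT17Cell20
import Summits.Ventures.PercRepro.RankLevelSetLevelSixT17Cell21
import Summits.Ventures.PercRepro.RankLevelSetLevelSixT17Cell22
import Summits.Ventures.PercRepro.RankLevelSetLevelSixT17Cell23
import Summits.Ventures.PercRepro.RankLevelSetLevelSixT17Cell24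
import Summits.Ventures.PercRepro.RankLevelSetLevelSixT17Cell25
import Summits.Ventures.PercRepro.RankLevelSetLevelSixT17Cell26
import Summits.Ventures.PercRepro.RankLevelSetLevelSixT17Cell27
import Summits.Ventures.PercRepro.RankLevelSetLevelSixT17Cell28
import Summits.Ventures.PercRepro.RankLevelSetLevelSixT17Cell29
import Summits.Ventures.PercRepro.RankLevelSetLevelSixT17Cell30
import Summits.Ventures.PercRepro.RankLevelSetLevelSixT17Cell31
import Summits.Ventures.PercRepro.RankLevelSetLevelSixT17Cell32
import Summits.Ventures.PercRepro.RankLevelSetLevelSixT17Cell33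
import Summits.Ventures.PercRepro.RankLevelSetLevelSixT17Cell34
import Summits.Ventures.PercRepro.RankLevelSetLevelSixT17Cell35
import Summits.Ventures.PercRepro.RankLevelSetLevelSixT17Cell36
import Summits.Ventures.PercRepro.RankLevelSetLevelSixT17Cell37
import Summits.Ventures.PercRepro.RankLevelSetLevelSixT17Cell38
import Summits.Ventures.PercRepro.RankLevelSetLevelSixT17Cell39
import Summits.Ventures.PercRepro.RankLevelSetLevelSixT17Cell40
import Summits.Ventures.PercRepro.RankLevelSetLevelSixT17Cell41
import Summits.Ventures.PercRepro.RankLevelSetLevelSixT17Cell42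
import Summits.Ventures.PercRepro.RankLevelSetLevelSixT17Cell43
import Summits.Ventures.PercRepro.RankLevelSetLevelSixT17Cell44
import Summits.Ventures.PercRepro.RankLevelSetLevelSixT17Cell45
import Summits.Ventures.PercRepro.RankLevelSetLevelSixT17Cell46
import Summits.Ventures.PercRepro.RankLevelSetLevelSixT17Cell47
import Summits.Ventures.PercRepro.RankLevelSetLevelSixT17Cell48
import Summits.Ventures.PercRepro.RankLevelSetLevelSixT17Cell49
import Summits.Ventures.PercRepro.RankLevelSetLevelSixT17Cell50
import Summits.Ventures.PercRepro.RankLevelSetLevelSixT17Cell51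
import Summits.Ventures.PercRepro.RankLevelSetLevelSixT17Cell52
import Summits.Ventures.PercRepro.RankLevelSetLevelSixT17Cell53
import Summits.Ventures.PercRepro.RankLevelSetLevelSixT17Cell54
import Summits.Ventures.PercRepro.RankLevelSetLevelSixT17Cell55
import Summits.Ventures.PercRepro.RankLevelSetLevelSixT17Cell56
import Summits.Ventures.PercRepro.RankLevelSetLevelSixT17BasisMid1a
import Summits.Ventures.PercRepro.RankLevelSetLevelSixT17BasisMid1b
import Summits.Ventures.PercRepro.RankLevelSetLevelSixT17BasisMid1c
import Summits.Ventures.PercRepro.RankLevelSetLevelSixT17BasisMid1d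
import Summits.Ventures.PercRepro.RankLevelSetLevelSixT17BasisMid1e
import Summits.Ventures.PercRepro.RankLevelSetLevelSixT17RegII
import Summits.Ventures.PercRepro.RankLevelSetLevelSixT18Assembly
import Summits.Ventures.PercRepro.RankLevelSetLevelFiveCqFifteen

/-!
# PercRepro — THE 17 ROW: `c025_six_large_seventeen (17 ≤ p) : RLS M p 6` — C-025 AT LEVEL `6` FOR EVERY `p ≥ 17`, EVERY FINITE MATROID (p8 g15, S3)

The core cells `(17, d)`: `d ∈ [7, 8, 9, 10, 11, 12, 13, 14, 15, 16, 17, 18, 19, 20, 21, 22, 23, 24, 25, 26, 27, 28, 29, 30, 31, 32, 33, 34, 35, 36, 37, 38, 39, 40, 41, 42, 43, 44, 45, 46, 47, 48, 49, 50, 51, 52, 53, 54, 55, 56]` by THE COLOOP DEVICE WITH THE LP CHAIN (`c025_core_six_seventeen_d`: `k = 0` and the chain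
steps the coloop-free cells of p2's nullity-split coloop/closure LP run at level `6` (`S3LP.s6lp_*`, natural or scaled), then the
exported-count rows and the trivial rows), `41 … 41, 43 … 43, 45 … 45, 47 … 47, 49 … 49` by the basis cells
(`c025_core_six_t17_basis_mid1a, c025_core_six_t17_basis_mid1b, c025_core_six_t17_basis_mid1c, c025_core_six_t17_basis_mid1d, c025_core_six_t17_basis_mid1e`), `d ≥ 57` by regime II (`c025_core_six_regII_basis_17`). Then the level-5 glue:
`rls_six_at_of_core 17` on p7's `c025_five_large_sharp15` (level `5` at `p = 16`) and the 18 row (`c025_six_large_eighteen`) for `p ≥ 18`.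
Axioms: standard.
-/

open scoped Matroid

namespace PercRepro

namespace ThmN

variable {α : Type}

/-- **The core cell `(17, d)` at every corank `d ≥ 57`, every `e`-free core** (the basis cells and regime II). -/
theorem c025_core_six_seventeen_large (M : Matroid α) [M.Finite] (d : ℕ) (hd : 57 ≤ d)
    (hR : M.eRank = (17 : ℕ∞)) (hn : M.E.ncard = 17 + d)
    (hfree : ∀ e ∈ M.E, ∃ A ⊆ M.E \ {e}, e ∉ M.closure A ∧ e ∉ M.closure ((M.E \ {e}) \ A)) :
    RLS M 17 6 := by
  exact c025_core_six_regII_basis_17 M d (by omega) hR hn hfree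

/-- **The core cell `(17, d)` at every corank `d ≥ 7`, every `e`-free core.** -/
theorem c025_core_six_seventeen (M : Matroid α) [M.Finite] (d : ℕ) (hd7 : 7 ≤ d)
    (hR : M.eRank = (17 : ℕ∞)) (hn : M.E.ncard = 17 + d)
    (hfree : ∀ e ∈ M.E, ∃ A ⊆ M.E \ {e}, e ∉ M.closure A ∧ e ∉ M.closure ((M.E \ {e}) \ A)) :
    RLS M 17 6 := by
  rcases Nat.lt_or_ge d 57 with hlt | hge
  · interval_cases d
    · exact c025_core_six_seventeen_7 M hR hn hfree
    · exact c025_core_six_seventeen_8 M hR hn hfree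
    · exact c025_core_six_seventeen_9 M hR hn hfree
    · exact c025_core_six_seventeen_10 M hR hn hfree
    · exact c025_core_six_seventeen_11 M hR hn hfree
    · exact c025_core_six_seventeen_12 M hR hn hfree
    · exact c025_core_six_seventeen_13 M hR hn hfree
    · exact c025_core_six_seventeen_14 M hR hn hfree
    · exact c025_core_six_seventeen_15 M hR hn hfree
    · exact c025_core_six_seventeen_16 M hR hn hfree
    · exact c025_core_six_seventeen_17 M hR hn hfree
    · exact c025_core_six_seventeen_18 M hR hn hfree
    · exact c025_core_six_seventeen_19 M hR hn hfree
    · exact c025_core_six_seventeen_20 M hR hn hfree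
    · exact c025_core_six_seventeen_21 M hR hn hfree
    · exact c025_core_six_seventeen_22 M hR hn hfree
    · exact c025_core_six_seventeen_23 M hR hn hfree
    · exact c025_core_six_seventeen_24 M hR hn hfree
    · exact c025_core_six_seventeen_25 M hR hn hfree
    · exact c025_core_six_seventeen_26 M hR hn hfree
    · exact c025_core_six_seventeen_27 M hR hn hfree
    · exact c025_core_six_seventeen_28 M hR hn hfree
    · exact c025_core_six_seventeen_29 M hR hn hfree
    · exact c025_core_six_seventeen_30 M hR hn hfree
    · exact c025_core_six_seventeen_31 M hR hn hfree
    · exact c025_core_six_seventeen_32 M hR hn hfree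
    · exact c025_core_six_seventeen_33 M hR hn hfree
    · exact c025_core_six_seventeen_34 M hR hn hfree
    · exact c025_core_six_seventeen_35 M hR hn hfree
    · exact c025_core_six_seventeen_36 M hR hn hfree
    · exact c025_core_six_seventeen_37 M hR hn hfree
    · exact c025_core_six_seventeen_38 M hR hn hfree
    · exact c025_core_six_seventeen_39 M hR hn hfree
    · exact c025_core_six_seventeen_40 M hR hn hfree
    · exact c025_core_six_seventeen_41 M hR hn hfree
    · exact c025_core_six_seventeen_42 M hR hn hfree
    · exact c025_core_six_seventeen_43 M hR hn hfree
    · exact c025_core_six_seventeen_44 M hR hn hfree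
    · exact c025_core_six_seventeen_45 M hR hn hfree
    · exact c025_core_six_seventeen_46 M hR hn hfree
    · exact c025_core_six_seventeen_47 M hR hn hfree
    · exact c025_core_six_seventeen_48 M hR hn hfree
    · exact c025_core_six_seventeen_49 M hR hn hfree
    · exact c025_core_six_seventeen_50 M hR hn hfree
    · exact c025_core_six_seventeen_51 M hR hn hfree
    · exact c025_core_six_seventeen_52 M hR hn hfree
    · exact c025_core_six_seventeen_53 M hR hn hfree
    · exact c025_core_six_seventeen_54 M hR hn hfree
    · exact c025_core_six_seventeen_55 M hR hn hfree
    · exact c025_core_six_seventeen_56 M hR hn hfree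
  · exact c025_core_six_seventeen_large M d hge hR hn hfree

/-- **THEOREM C₆ AT RANK `17`, GIVEN LEVEL `5`**: level `5` for all `p ≥ 16` implies level `6` for all `p ≥ 17`
(`p = 17` by the cells and `rls_six_at_of_core`; `p ≥ 18` by the 18 row). -/
theorem c025_six_of_five_t17
    (h5 : ∀ (M : Matroid α) [M.Finite] (p : ℕ), 16 ≤ p → RLS M p 5) :
    ∀ (M : Matroid α) [M.Finite] (p : ℕ), 17 ≤ p → RLS M p 6 := by
  intro M _ p hp
  rcases Nat.lt_or_ge p 18 with hlt | hge
  · have hP : p = 17 := by omega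
    subst hP
    refine rls_six_at_of_core 17 (by norm_num) (fun M _ => h5 M 16 (by norm_num)) ?_ M
    intro M _ d hd hR hn hfree
    exact c025_core_six_seventeen M d hd hR hn hfree
  · exact c025_six_large_eighteen M p hge

/-- **C-025 AT LEVEL `6` FOR EVERY `p ≥ 17`, EVERY FINITE MATROID** — on p7's `c025_five_large_sharp15 (15 ≤ p)`. -/
theorem c025_six_large_seventeen (M : Matroid α) [M.Finite] (p : ℕ) (hp : 17 ≤ p) : RLS M p 6 :=
  c025_six_of_five_t17 (fun M _ p hp => c025_five_large_sharp15 M p (by omega)) M p hp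

end ThmN

end PercRepro
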